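/-
Copyright (c) 2026 the pub-hodgecm-mathlib formalisation cell (harness21).  Prover seat hodgecm-mathlib-K2E3-p05 (g3), Track B «K2-LIT», engine E3, unit U4 «Keys»,
2026-09-04.  KERNEL module: THEOREMS ONLY (no definition, no named fact, no `sorry`, no instance, no notation).
-/
import Summits.HodgeConjecture.HodgeConjecture.Theorems.K2E3KeysThmTwoIwahoriQuartet            -- ★-filed p856874 (this seat): `apply_uniformizer_eq_or_eq` (the quartet), `eq_one_of_levelTrivial`; brings ★ II-1…II-4 bricks, ★ p856662
import Summits.HodgeConjecture.HodgeConjecture.Theorems.K2E3UnramifiedSignCharQuadratic          -- ★-filed p856887 (this seat): `isQuadraticCharExtension_of_unramified_of_apply_uniformizer`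
import Summits.HodgeConjecture.HodgeConjecture.Theorems.K2E3UnramifiedCharacterValueAtUniformizer  -- ★ p855859 (g0): `eq_halfModulusChar_sq_of_apply_uniformizer`, `eq_mul_halfModulusChar`, `continuous_coe_mul_halfModulusChar_inv`, `halfModulusChar_eq_one_of_mem_unitsIntegers`
import Literature.NumberTheory.Automorphic.HyperspecialUnitaryCartanAdicCompletion                -- ★ `unramifiedLocalConjDatum_adicCompletion` (the unramified datum at an inert place)
import HarnessLib

/-!
# K2 ∕ E3 «EllipticInputs», unit U4 «Keys» — Road II of MEMO `hK-KeysThmTwo`: THE UNRAMIFIED RUNG OF U4-f.  Keys' Theorem §7 (2) in its «Re s > 0» normal form, AT EVERY INERT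
# PLACE AND FOR EVERY `χ` TRIVIAL ON `T ∩ K_v`: a reducible `i_G(χ₁, χ₂)` with `χ₁` non-unitary contracting has `χ₁ = ‖·‖_E` or `χ₁ = η‖·‖_E^{1∕2}`, `η|F^× = ω_{E∕F}`
# [Keys1984 §7 Thm (2) (a)(c); Rogawski1990 §12.2 (1)(2); Casselman1980 §3; Borel1976 §4]

Cell hodgecm-mathlib (D-0151), FLOOR 0, Track B «K2-LIT», engine E3, crux item H413 = stmt-HodgeConjecture-24833 (route `HCCMUnconditional`, no route verbs); target BY NAME
`…K2E3EllipticInputs.U4Keys.sig_K2E3KeysThmTwoContracting` (U4-f, U4Keys ED. 4).  Author K2E3-p05 (g3).  `--supports stmt-HodgeConjecture-24833 --as helper`; THEOREMS ONLY.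
THIS FILE IS THE FIRST RUNG, NOT THE PAYER: the statement is U4-f's binder text VERBATIM plus two hypotheses — `hunr : v` unramified in `L∕L⁺` (with `hns`: `v` INERT) and
`hU : χ = (χ₁, χ₂)` trivial on `T ∩ K_v` (UNRAMIFIED `χ`).  The ramified places and the ramified characters are the residue of U4-f (Road I ∕ deeper types).

THE MATHEMATICS.  The (G3)-EXPLICIT letters are PRODUCED here (as in ★ (G3) `exists_epFunction_G`): `w ∣ v` (unique), the unramified datum `(ϖ, hd)` of `σ_w` (★
`unramifiedLocalConjDatum_adicCompletion`), `g₁ = diag(1, 1, ϖ)`, the one-place model `eA = ` ★ `localNonsplitEquiv` re-read on `Φ₃ = antidiag(1,1,1)`, and the levels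
`K₀ = eA⁻¹(GL₃(𝒪_w) ∩ U)`, `K₁ = eA⁻¹(g₁GL₃(𝒪_w)g₁⁻¹ ∩ U)`, `I = K₀ ⊓ K₁`.  ★ `apply_uniformizer_eq_or_eq` (the quartet) gives `z := χ₁(ϖ_E) ∈ {q⁻², −q⁻¹}` for a uniformiser
unit `ϖ_E` of `E_v` (★ `exists_uniformizer_units`), and `χ₁ = 1` on `𝒪_vˣ` (★ (H1)).  (a) `z = q⁻² = ‖ϖ_E‖ = (‖ϖ_E‖^{1∕2})²` (★ `unitModulusChar_uniformizer_eq_inv_sq`) ⇒ `χ₁ = ‖·‖_E`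
(★ `eq_halfModulusChar_sq_of_apply_uniformizer`) — the first disjunct.  (c) `z = −q⁻¹`: `η := χ₁‖·‖^{−1∕2}` is continuous (★), trivial on `𝒪_vˣ` (★ `halfModulusChar_eq_one_of_mem_unitsIntegers`),
`η(ϖ_E) = −q⁻¹·q = −1`, hence `η|_{F_v^×} = ω_{E_v∕F_v}` (★ `isQuadraticCharExtension_of_unramified_of_apply_uniformizer`), and `χ₁ = η‖·‖^{1∕2}` (★ `eq_mul_halfModulusChar`) — the
second disjunct.
HONEST LABEL: HC_CM is proved only modulo the 7 printed citations (2 remaining named inputs: hLiu418 = stmt-HodgeConjecture-24832, h413 = stmt-HodgeConjecture-24833)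
until rung 0 closes; count-neutral — the unramified rung does NOT pay U4-f (`hunr`, `hU` are extra hypotheses); no printed citation is discharged.

## References
* [Keys1984] D. Keys, *Principal series representations of special unitary groups over local fields*, Compositio Math. 51 (1984), §7 Theorem (2) (a)(c) p. 126.
* [Rogawski1990] J. D. Rogawski, Ann. of Math. Stud. 123 (1990), §12.2 (1)(2) p. 173.  * [Casselman1980] W. Casselman, Compositio Math. 40 (1980), §3.
* [Borel1976] A. Borel, Invent. Math. 35 (1976), §4.  * [Tits1979] J. Tits, PSPM 33.1 (1979), §2.4.  * [Serre1979] J.-P. Serre, *Local Fields*, Ch. V §2 Prop. 3.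
-/

set_option autoImplicit false
-- the mandated namespace has the single-problem summit's repeated segment (`HodgeConjecture.HodgeConjecture`)
set_option linter.dupNamespace false

noncomputable section

open NumberField IsDedekindDomain MeasureTheory
open scoped Matrix MatrixGroups NNReal WithZero
open Literature.NumberTheory Literature.NumberTheory.Automorphic Literature.NumberTheory.Automorphic.UnitaryGroup
open Literature.NumberTheory.Rogawski1990 Literature.NumberTheory.GaloisRepresentations

namespace Summit.HodgeConjecture.HodgeConjecture.Cruxes.H413.K2E3KeysThmTwoContractingUnramified

open Summit.HodgeConjecture.HodgeConjecture.Cruxes.H413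
open Summit.HodgeConjecture.HodgeConjecture.Cruxes.H413.K2E3KeysThmTwoIwahoriQuartet
open Summit.HodgeConjecture.HodgeConjecture.Cruxes.H413.K2E3IwahoriScalarExplicit
open Summit.HodgeConjecture.HodgeConjecture.Cruxes.H413.K2E3UnramifiedCharacterValueAtUniformizer
open Summit.HodgeConjecture.HodgeConjecture.Cruxes.H413.K2E3UnramifiedSignCharQuadratic

set_option maxHeartbeats 6400000 in
set_option synthInstance.maxHeartbeats 400000 in
-- statement-level `whnf` on the CM carriers + the (G3) letters produced in the proof (class of ★ (G3) `exists_epFunction_G`)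
/-- **KEYS' THEOREM §7 (2) («Re s > 0» FORM) AT AN INERT PLACE FOR AN UNRAMIFIED `χ` — U4-f's conclusion VERBATIM under the two extra hypotheses `hunr` (with `hns`: `v` inert)
and `hU` (`χ` trivial on `T ∩ K_v`).**  `L` CM, `v` a finite place of `L⁺` non-split (`hns`) and unramified (`hunr`) in `L`; `χ₁ : E_vˣ → ℂˣ`, `χ₂ : E¹_v → ℂˣ` continuous, `χ₁` NON-UNITARY
(`hnu`) and CONTRACTING (`hcontr`, «Re s > 0»), `χ = (χ₁, χ₂)` trivial on `T ∩ K_v`; if `i_G(χ)` has a proper non-zero `G_v`-stable subspace then `χ₁ = ‖·‖_E` (`= halfModulusChar²`) or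
`χ₁ = η‖·‖_E^{1∕2}` with `η|_{F_v^×} = ω_{E_v∕F_v}` (★ `IsQuadraticCharExtension`) and `η` continuous — Keys' points (a) `λ = 1, s = 1` and (c) `λ` unramified, `λ|F^× = ω_{E∕F}`, `s = 1∕2`.
[cite: Keys1984, §7 Theorem (2) (a)(c) p. 126] [cite: Rogawski1990, §12.2 (1)(2) p. 173] [cite: Casselman1980, §3] [cite: Borel1976, §4] -/
theorem keysThmTwoContracting_of_unramified_inert (L : Type) [Field L] [NumberField L] [IsCMField L] (v : HeightOneSpectrum (𝓞 ↥(maximalRealSubfield L)))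
    (hns : ∀ w : PlacesOver L v, IsCMField.complexConj L • w.1 = w.1) (hunr : Algebra.IsUnramifiedIn (𝓞 L) v.asIdeal)
    (χ₁ : (UnitaryGroup.LocalRing L v)ˣ →* ℂˣ) (χ₂ : ↥(normOneUnits (conjLocal L (IsCMField.complexConj L) v)) →* ℂˣ)
    (h₁ : Continuous (fun x => ((χ₁ x : ℂˣ) : ℂ))) (h₂ : Continuous (fun x => ((χ₂ x : ℂˣ) : ℂ))) (hnu : ∃ x, ‖((χ₁ x : ℂˣ) : ℂ)‖ ≠ 1)
    (hcontr : ∀ x : (UnitaryGroup.LocalRing L v)ˣ, unitModulusChar (UnitaryGroup.LocalRing L v) x < 1 → ‖((χ₁ x : ℂˣ) : ℂ)‖ < 1)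
    (hU : ∀ t : ↥(torusU (conjLocal L (IsCMField.complexConj L) v) (cmLocalForm L 3 v)),
      (t : ↥(unitaryGroupOfForm (conjLocal L (IsCMField.complexConj L) v) (cmLocalForm L 3 v))) ∈ cmLocalIntegralLevel L 3 (qsForm L) v → cmTorusCharPair L v χ₁ χ₂ t = 1)
    (hred : ∃ N : Subrepresentation (UnitaryGroup.cmPrincipalSeries L 3 v (UnitaryGroup.cmTorusCharPair L v χ₁ χ₂)), N ≠ ⊥ ∧ N ≠ ⊤) :
    χ₁ = halfModulusChar (UnitaryGroup.LocalRing L v) * halfModulusChar (UnitaryGroup.LocalRing L v) ∨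
      (∃ η : (UnitaryGroup.LocalRing L v)ˣ →* ℂˣ, IsQuadraticCharExtension (conjLocal L (IsCMField.complexConj L) v) η ∧
        Continuous (fun x => ((η x : ℂˣ) : ℂ)) ∧ χ₁ = η * halfModulusChar (UnitaryGroup.LocalRing L v)) := by
  classical
  obtain ⟨w⟩ : Nonempty (PlacesOver L v) := inferInstance
  have hw : IsCMField.complexConj L • w.1 = w.1 := hns w
  have hc1 : IsCMField.complexConj L ≠ 1 := IsCMField.complexConj_ne_one L
  haveI : Algebra.IsQuadraticExtension ↥(maximalRealSubfield L) L := IsCMField.isQuadraticExtension L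
  -- the (G3)-EXPLICIT letters at `w`: the unramified datum, the edge matrix, the one-place model, the three levels
  obtain ⟨ϖ, hd⟩ := unramifiedLocalConjDatum_adicCompletion (IsCMField.complexConj L) hc1 v w hw hunr
  have hϖ0 : ϖ ≠ 0 := fun h0 => by have hv := hd.vϖ; rw [h0, map_zero] at hv; exact WithZero.zero_ne_coe hv
  obtain ⟨g₁, hg₁⟩ : ∃ g₁ : GL (Fin 3) (w.1.adicCompletion L), (g₁ : Matrix (Fin 3) (Fin 3) (w.1.adicCompletion L)) = Matrix.diagonal ![(1 : w.1.adicCompletion L), 1, ϖ] := by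
    refine ⟨glDiagonal 3 (w.1.adicCompletion L) ![1, 1, Units.mk0 ϖ hϖ0], ?_⟩
    rw [coe_glDiagonal]
    congr 1
    funext i
    fin_cases i <;> rfl
  have hJw : placeForm (qsForm L) w.1 = (StdForm.antidiagonal 3).over (w.1.adicCompletion L) := by
    rw [placeForm, qsForm, antidiagOne_eq_over, StdForm.over_map]
  obtain ⟨eA, heA⟩ : ∃ eA : Gqs L v ≃ₜ* ↥(unitaryGroupOfForm (galAdicCompletionMap (L := L) (IsCMField.complexConj L) hw) ((StdForm.antidiagonal 3).over (w.1.adicCompletion L))),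
      ∀ g : Gqs L v, ((eA g : ↥(unitaryGroupOfForm (galAdicCompletionMap (L := L) (IsCMField.complexConj L) hw) ((StdForm.antidiagonal 3).over (w.1.adicCompletion L)))) :
          GL (Fin 3) (w.1.adicCompletion L)) =
        ((localNonsplitEquiv (IsCMField.complexConj L) (qsForm L) (IsCMField.complexConj_ne_one L) w hw g :
          ↥(unitaryGroupOfForm (galAdicCompletionMap (L := L) (IsCMField.complexConj L) hw) (placeForm (qsForm L) w.1))) : GL (Fin 3) (w.1.adicCompletion L)) := by
    rw [← hJw]
    exact ⟨localNonsplitEquiv (IsCMField.complexConj L) (qsForm L) (IsCMField.complexConj_ne_one L) w hw, fun g => rfl⟩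
  -- a uniformiser unit of `E_v` and the quartet
  obtain ⟨ϖE, hϖE⟩ := F0P3cStCharTSTorusRay.exists_uniformizer_units L v
  have hquart := apply_uniformizer_eq_or_eq L v w hw eA heA hns hunr hd g₁ hg₁ _ _ _ rfl rfl rfl χ₁ χ₂ h₁ h₂ hnu hcontr hU hred ϖE hϖE
  -- `χ₁` is unramified; the modulus of `ϖ_E`
  have hχ₁U : ∀ u ∈ (Submonoid.pi Set.univ (fun w' : PlacesOver L v => (w'.1.adicCompletionIntegers L).toSubring.toSubmonoid)).units, χ₁ u = 1 :=
    fun u hu => K2E3SphericalCFunctionUnramifiedHypotheses.apply_eq_one_of_mem_unitsIntegers_of_trivial L v hns χ₁ χ₂ hU u hu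
  have hq0 : (Nat.card (𝓞 ↥(maximalRealSubfield L) ⧸ v.asIdeal) : ℂ) ≠ 0 := by
    haveI : Finite (𝓞 ↥(maximalRealSubfield L) ⧸ v.asIdeal) := Ideal.finiteQuotientOfFreeOfNeBot v.asIdeal v.ne_bot
    haveI : Nontrivial (𝓞 ↥(maximalRealSubfield L) ⧸ v.asIdeal) := Ideal.Quotient.nontrivial_iff.2 v.isPrime.ne_top
    have h := Finite.one_lt_card (α := 𝓞 ↥(maximalRealSubfield L) ⧸ v.asIdeal)
    exact_mod_cast (show Nat.card (𝓞 ↥(maximalRealSubfield L) ⧸ v.asIdeal) ≠ 0 by omega)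
  -- `‖ϖ_E‖^{1∕2} = q⁻¹` as a complex number
  have hhalf : ((halfModulusChar (UnitaryGroup.LocalRing L v) ϖE : ℂˣ) : ℂ) = ((Nat.card (𝓞 ↥(maximalRealSubfield L) ⧸ v.asIdeal) : ℂ))⁻¹ := by
    rw [coe_halfModulusChar_apply, unitModulusChar_uniformizer_eq_inv_sq L v hns hunr ϖE hϖE, NNReal.sqrt_inv, Nat.cast_pow, NNReal.sqrt_sq,
      NNReal.coe_inv, NNReal.coe_natCast, Complex.ofReal_inv, Complex.ofReal_natCast]
  rcases hquart with hz | hz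
  · -- (a) `χ₁(ϖ_E) = q⁻² = ‖ϖ_E‖`: `χ₁ = ‖·‖_E`
    left
    refine eq_halfModulusChar_sq_of_apply_uniformizer L v hns ϖE hϖE χ₁ hχ₁U (Units.ext ?_)
    rw [Units.val_mul, hhalf, hz, ← mul_inv, sq]
  · -- (c) `χ₁(ϖ_E) = −q⁻¹`: `η = χ₁‖·‖^{-1∕2}` is unramified with `η(ϖ_E) = −1`, so `η|F^× = ω_{E∕F}`
    right
    refine ⟨χ₁ * (halfModulusChar (UnitaryGroup.LocalRing L v))⁻¹, ?_, continuous_coe_mul_halfModulusChar_inv L v χ₁ h₁, eq_mul_halfModulusChar L v χ₁⟩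
    refine isQuadraticCharExtension_of_unramified_of_apply_uniformizer L v hns hunr _ (fun u hu => ?_) ϖE hϖE (Units.ext ?_)
    · rw [MonoidHom.mul_apply, MonoidHom.inv_apply, hχ₁U u hu, halfModulusChar_eq_one_of_mem_unitsIntegers L v u hu, inv_one, mul_one]
    · rw [MonoidHom.mul_apply, MonoidHom.inv_apply, Units.val_mul, Units.val_inv_eq_inv_val, hz, hhalf, inv_inv, Units.val_neg, Units.val_one,
        neg_mul, inv_mul_cancel₀ hq0]

end Summit.HodgeConjecture.HodgeConjecture.Cruxes.H413.K2E3KeysThmTwoContractingUnramified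

end
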